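import Mathlib
import Summits.Ventures.HodgeRepro.OcticCMPointInertModel

/-!
# OcticCMPointInertGauss — the Gauss sums of the conjugate-dual characters at `𝔮 | 2` are exactly `+4`

Blind re-derivation cell `pub-hodge-repro`, seat night-2 (gen 4).  Target tree path
`lean/Summits/Ventures/HodgeRepro/OcticCMPointInertGauss.lean`.  Sharpens `OcticCMPointInertModel.lean`'s
`𝔤(ω, ψ̃) = ±4` to **`𝔤(ω, ψ̃) = 4`** for every non-trivial conjugate-dual tame `ω` at the inert place `𝔮 | 2`
of the octic point (`𝔽₁₆ = GaloisField 2 4`, `ψ̃ = ψ₀ ∘ Tr_{𝔽₁₆/𝔽₂}`), and hence the conductor-`1` root number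
**`ε(½, ω, ψ̃) = ω(ϖ)^n` exactly** (`κ = ¼`), with no sign ambiguity — the value the seat's numerics
(`proofs/night-2/g4/numerics/check_inert.py`) found for all four characters of order `5`.

The argument is the `𝔽₄`-coset one: a conjugate-dual `ω` has order dividing `5` (`conjDual_iff_pow_five`), so
it is trivial on `𝔽₄^× = {1, α, α²}` (`α² + α + 1 = 0`); averaging the Gauss sum over the three reindexings
`x ↦ x, αx, α²x` gives `3 𝔤 = ∑_x ω(x) (ψ̃(x) + ψ̃(αx) + ψ̃(x)ψ̃(αx))`, the bracket is `3` on the set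
`{Tr x = 0, Tr(αx) = 0}` and `−1` off it, the set is exactly the subfield `𝔽₄ = {x : x⁴ = x}` (the trace in closed
form `Tr x = x + x² + x⁴ + x⁸`, Mathlib `FiniteField.algebraMap_trace_eq_sum_pow`), and `∑_{𝔽₄} ω = 3`, so
`3 𝔤 = 4 · 3 − 0`.

* `algebraMap_tr`, `tr_eq_zero_iff` — the trace of `𝔽₁₆/𝔽₂` in closed form;
* `exists_cubeRoot` — a primitive cube root of unity `α ∈ 𝔽₁₆`;
* `pow_four_eq_self_iff` — `x⁴ = x ↔ x ∈ {0, 1, α, α²}`;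
* `gaussSum_eq_four` — **`𝔤(ω, ψ̃) = 4`**;
* `eps_eq_piVal_pow` — **`ε(½, ω, ψ̃) = ω(ϖ)^n`** for every non-trivial conjugate-dual tame `ω`.

**What this is not.**  Conductors `c ≥ 2` at `𝔮` are not transcribed.  Nothing here says anything about the
status of the Hodge conjecture for CM abelian varieties, which is NOT proved.
-/

set_option autoImplicit false

noncomputable section

open Finset

namespace Summit.Ventures.HodgeRepro.PeriodCloser

namespace InertModel

/-! ### The trace of `𝔽₁₆/𝔽₂` in closed form -/

/-- **`Tr_{𝔽₁₆/𝔽₂}(x) = x + x² + x⁴ + x⁸`** (Mathlib's `FiniteField.algebraMap_trace_eq_sum_pow`). -/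
theorem algebraMap_tr (x : F16) : algebraMap (ZMod 2) F16 (tr x) = x + x ^ 2 + x ^ 4 + x ^ 8 := by
  have h := FiniteField.algebraMap_trace_eq_sum_pow (ZMod 2) F16 x
  rw [GaloisField.finrank 2 (by norm_num : (4 : ℕ) ≠ 0), Nat.card_zmod] at h
  change algebraMap (ZMod 2) F16 (Algebra.trace (ZMod 2) F16 x) = _
  rw [h, Finset.sum_range_succ, Finset.sum_range_succ, Finset.sum_range_succ, Finset.sum_range_succ,
    Finset.sum_range_zero]
  norm_num

/-- `Tr x = 0 ↔ x + x² + x⁴ + x⁸ = 0`. -/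
theorem tr_eq_zero_iff (x : F16) : tr x = 0 ↔ x + x ^ 2 + x ^ 4 + x ^ 8 = 0 := by
  rw [← algebraMap_tr, map_eq_zero_iff _ (algebraMap (ZMod 2) F16).injective]

/-- `ψ̃(x) = 1 ↔ Tr x = 0` for a non-trivial `ψ₀`. -/
theorem psiTilde_eq_one_iff (ψ₀ : AddChar (ZMod 2) ℂ) (h₀ : ψ₀ 1 ≠ 1) (x : F16) :
    psiTilde ψ₀ x = 1 ↔ tr x = 0 := by
  rw [psiTilde_apply]
  change ψ₀ (tr x) = 1 ↔ tr x = 0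
  have h2 : ∀ t : ZMod 2, t = 0 ∨ t = 1 := by decide
  rcases h2 (tr x) with h | h
  · rw [h, AddChar.map_zero_eq_one]
    exact ⟨fun _ => rfl, fun _ => rfl⟩
  · rw [h]
    exact ⟨fun h1 => absurd h1 h₀, fun h1 => absurd h1 (by decide)⟩

/-- The values of `ψ̃` are `±1`: `ψ₀(1)² = ψ₀(2) = 1`, and `ψ₀(1) ≠ 1`. -/
theorem psiTilde_eq_one_or_neg_one (ψ₀ : AddChar (ZMod 2) ℂ) (h₀ : ψ₀ 1 ≠ 1) (x : F16) :
    psiTilde ψ₀ x = 1 ∨ psiTilde ψ₀ x = -1 := by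
  rw [psiTilde_apply]
  change ψ₀ (tr x) = 1 ∨ ψ₀ (tr x) = -1
  have h2 : ∀ t : ZMod 2, t = 0 ∨ t = 1 := by decide
  rcases h2 (tr x) with h | h
  · left; rw [h, AddChar.map_zero_eq_one]
  · right
    rw [h]
    have hsq : ψ₀ 1 * ψ₀ 1 = 1 := by
      rw [← AddChar.map_add_eq_mul]
      have : (1 : ZMod 2) + 1 = 0 := by decide
      rw [this, AddChar.map_zero_eq_one]
    have hsq' : ψ₀ 1 ^ 2 = (1 : ℂ) ^ 2 := by rw [sq, hsq, one_pow]
    rcases sq_eq_sq_iff_eq_or_eq_neg.1 hsq' with h1 | h1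
    · exact absurd h1 h₀
    · exact h1

/-! ### A primitive cube root of unity in `𝔽₁₆` -/

/-- **`𝔽₁₆^×` (order `15`) contains an element of order `3`** (Cauchy): a primitive cube root of unity `α`. -/
theorem exists_cubeRoot : ∃ α : F16, α ≠ 1 ∧ α ^ 3 = 1 := by
  classical
  have hcard : Fintype.card F16ˣ = 15 := by
    rw [Fintype.card_units, card_galoisField_two_four]; rfl
  obtain ⟨u, hu⟩ := exists_prime_orderOf_dvd_card 3 (by rw [hcard]; norm_num)
  refine ⟨(u : F16), ?_, ?_⟩
  · intro h
    have h1 : u = 1 := Units.ext h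
    rw [h1, orderOf_one] at hu
    norm_num at hu
  · have h3 : u ^ 3 = 1 := by rw [← hu]; exact pow_orderOf_eq_one u
    have := congrArg Units.val h3
    simpa using this

/-- `α ≠ 0`, `α² ≠ 0`, `α² ≠ 1`, `α² ≠ α`, `α² = α + 1` for a primitive cube root of unity `α` (char `2`). -/
theorem cubeRoot_facts {α : F16} (hα1 : α ≠ 1) (hα3 : α ^ 3 = 1) :
    α ≠ 0 ∧ α ^ 2 ≠ 0 ∧ α ^ 2 ≠ 1 ∧ α ^ 2 ≠ α ∧ α ^ 2 + α + 1 = 0 ∧ α ^ 2 = α + 1 := by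
  have hα0 : α ≠ 0 := by
    rintro rfl
    rw [zero_pow (by norm_num)] at hα3
    exact zero_ne_one hα3
  have hquad : α ^ 2 + α + 1 = 0 := by
    have h : (α - 1) * (α ^ 2 + α + 1) = 0 := by
      have : (α - 1) * (α ^ 2 + α + 1) = α ^ 3 - 1 := by ring
      rw [this, hα3, sub_self]
    rcases mul_eq_zero.1 h with h | h
    · exact absurd (sub_eq_zero.1 h) hα1
    · exact h
  refine ⟨hα0, pow_ne_zero 2 hα0, ?_, ?_, hquad, ?_⟩
  · intro h
    apply hα1
    calc α = α * α ^ 2 := by rw [h, mul_one]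
      _ = α ^ 3 := by ring
      _ = 1 := hα3
  · intro h
    have h' : α * (α - 1) = 0 := by rw [mul_sub, mul_one, ← sq, h, sub_self]
    rcases mul_eq_zero.1 h' with h1 | h1
    · exact hα0 h1
    · exact hα1 (sub_eq_zero.1 h1)
  · have := hquad
    rw [add_assoc] at this
    have h2 : α ^ 2 = -(α + 1) := eq_neg_of_add_eq_zero_left this
    rw [h2, neg_eq]

/-- **`x⁴ = x ↔ x ∈ {0, 1, α, α²}`**: `x⁴ − x = x (x − 1)(x − α)(x − α²)` in `𝔽₁₆`. -/
theorem pow_four_eq_self_iff {α : F16} (hα1 : α ≠ 1) (hα3 : α ^ 3 = 1) (x : F16) :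
    x ^ 4 = x ↔ x = 0 ∨ x = 1 ∨ x = α ∨ x = α ^ 2 := by
  obtain ⟨-, -, -, -, hquad, -⟩ := cubeRoot_facts hα1 hα3
  constructor
  · intro h
    have hfac : x * (x - 1) * ((x - α) * (x - α ^ 2)) = 0 := by
      have : x * (x - 1) * ((x - α) * (x - α ^ 2)) = x ^ 4 - x := by
        linear_combination (-(x * (x - 1) * (x - α + 1))) * hquad
      rw [this, h, sub_self]
    rcases mul_eq_zero.1 hfac with h1 | h1
    · rcases mul_eq_zero.1 h1 with h2 | h2
      · exact Or.inl h2
      · exact Or.inr (Or.inl (sub_eq_zero.1 h2))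
    · rcases mul_eq_zero.1 h1 with h2 | h2
      · exact Or.inr (Or.inr (Or.inl (sub_eq_zero.1 h2)))
      · exact Or.inr (Or.inr (Or.inr (sub_eq_zero.1 h2)))
  · rintro (h | h | h | h)
    · rw [h]; simp
    · rw [h]; simp
    · rw [h]
      calc α ^ 4 = α * α ^ 3 := by ring
        _ = α := by rw [hα3, mul_one]
    · rw [h]
      calc (α ^ 2) ^ 4 = (α ^ 3) ^ 2 * α ^ 2 := by ring
        _ = α ^ 2 := by rw [hα3, one_pow, one_mul]

/-- **The trace kernel condition `Tr x = 0 ∧ Tr(αx) = 0` cuts out exactly `𝔽₄ = {x : x⁴ = x}`**: with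
`t = x + x⁴` (the relative trace to `𝔽₄`), `Tr x = t + t²` and `Tr(αx) = αt + α²t²`, so both vanish iff
`t = 0`. -/
theorem tr_zero_and_tr_mul_zero_iff {α : F16} (hα1 : α ≠ 1) (hα3 : α ^ 3 = 1) (x : F16) :
    (tr x = 0 ∧ tr (α * x) = 0) ↔ x ^ 4 = x := by
  obtain ⟨-, -, -, -, hquad, -⟩ := cubeRoot_facts hα1 hα3
  have hα4 : α ^ 4 = α := by
    calc α ^ 4 = α * α ^ 3 := by ring
      _ = α := by rw [hα3, mul_one]
  have hα8 : α ^ 8 = α ^ 2 := by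
    calc α ^ 8 = (α ^ 3) ^ 2 * α ^ 2 := by ring
      _ = α ^ 2 := by rw [hα3, one_pow, one_mul]
  rw [tr_eq_zero_iff, tr_eq_zero_iff]
  have hsq : ∀ y : F16, (y + y ^ 4) ^ 2 = y ^ 2 + y ^ 8 := by
    intro y
    rw [add_pow_char _ _ 2]
    ring
  constructor
  · rintro ⟨h1, h2⟩
    -- `t + t² = 0` and `α t + α² t² = 0` with `t = x + x⁴` the relative trace to `𝔽₄`
    have e1 : (x + x ^ 4) + (x + x ^ 4) ^ 2 = 0 := by rw [hsq]; linear_combination h1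
    have e2 : α * (x + x ^ 4) + α ^ 2 * (x + x ^ 4) ^ 2 = 0 := by
      rw [hsq]
      rw [mul_pow, mul_pow, mul_pow, hα4, hα8] at h2
      linear_combination h2
    have ht2 : (x + x ^ 4) ^ 2 = x + x ^ 4 := by
      have := eq_neg_of_add_eq_zero_right e1
      rw [this, neg_eq]
    rw [ht2, ← add_mul] at e2
    have hsum : α + α ^ 2 = 1 := by
      have h' : α + α ^ 2 = -1 := by linear_combination hquad
      rw [h', neg_eq]
    rw [hsum, one_mul] at e2
    -- `t = 0`, i.e. `x⁴ = −x = x`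
    have := eq_neg_of_add_eq_zero_right e2
    rw [neg_eq] at this
    exact this
  · intro h
    have h8 : x ^ 8 = x ^ 2 := by
      calc x ^ 8 = (x ^ 4) ^ 2 := by ring
        _ = x ^ 2 := by rw [h]
    constructor
    · rw [h, h8]
      have : x + x ^ 2 + x + x ^ 2 = (x + x ^ 2) + (x + x ^ 2) := by ring
      rw [this, add_self_eq_zero]
    · rw [mul_pow, mul_pow, mul_pow, hα4, hα8, h, h8]
      have : α * x + α ^ 2 * x ^ 2 + α * x + α ^ 2 * x ^ 2 =
          (α * x + α ^ 2 * x ^ 2) + (α * x + α ^ 2 * x ^ 2) := by ring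
      rw [this, add_self_eq_zero]

/-! ### The characters of order dividing `5` are trivial on `𝔽₄^×` -/

/-- A value `a` with `a³ = 1` and `a⁵ = 1` is `1`. -/
theorem eq_one_of_pow_three_of_pow_five {a : ℂ} (h3 : a ^ 3 = 1) (h5 : a ^ 5 = 1) : a = 1 := by
  have h2 : a ^ 2 = 1 := by
    have : a ^ 5 = a ^ 3 * a ^ 2 := by ring
    rw [h5, h3, one_mul] at this
    exact this.symm
  calc a = a * a ^ 2 := by rw [h2, mul_one]
    _ = a ^ 3 := by ring
    _ = 1 := h3

/-- A character of `𝔽₁₆^×` of order dividing `5` is trivial on the cube roots of unity. -/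
theorem mulChar_cubeRoot_eq_one (ω : MulChar F16 ℂ) (h5 : ∀ x, x ≠ 0 → ω x ^ 5 = 1) {a : F16}
    (ha3 : a ^ 3 = 1) : ω a = 1 := by
  have ha0 : a ≠ 0 := by
    rintro rfl
    rw [zero_pow (by norm_num)] at ha3
    exact zero_ne_one ha3
  refine eq_one_of_pow_three_of_pow_five ?_ (h5 a ha0)
  rw [← map_pow, ha3, MulChar.map_one]

/-! ### The Gauss sum -/

/-- Reindexing the Gauss sum by `x ↦ u x` for a unit `u` with `ω(u) = 1`. -/
theorem gaussSum_eq_sum_mulShift (ω : MulChar F16 ℂ) (ψ : AddChar F16 ℂ) {u : F16} (hu0 : u ≠ 0)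
    (hωu : ω u = 1) : gaussSum ω ψ = ∑ x, ω x * ψ (u * x) := by
  unfold gaussSum
  refine (Fintype.sum_equiv (Equiv.mulLeft₀ u hu0) (fun x => ω x * ψ (u * x)) (fun x => ω x * ψ x)
    fun x => ?_).symm
  change ω x * ψ (u * x) = ω (u * x) * ψ (u * x)
  rw [map_mul ω u x, hωu, one_mul]

/-- **`𝔤(ω, ψ̃) = 4` for every non-trivial conjugate-dual tame `ω` at `𝔮 | 2`** — the sign of
`gaussSum_eq_four_or_neg_four` is `+`. -/
theorem gaussSum_eq_four (ψ₀ : AddChar (ZMod 2) ℂ) (h₀ : ψ₀ 1 ≠ 1) (ω : MulChar F16 ℂ) (hω : ω ≠ 1)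
    (hσ : ∀ x, ω (conj x) = ω⁻¹ x) : gaussSum ω (psiTilde ψ₀) = 4 := by
  classical
  have h5 : ∀ x, x ≠ 0 → ω x ^ 5 = 1 := (conjDual_iff_pow_five ω).1 hσ
  obtain ⟨α, hα1, hα3⟩ := exists_cubeRoot
  obtain ⟨hα0, hα20, hα21, hα2α, -, hα2⟩ := cubeRoot_facts hα1 hα3
  have hωα : ω α = 1 := mulChar_cubeRoot_eq_one ω h5 hα3
  have hωα2 : ω (α ^ 2) = 1 := by rw [map_pow, hωα, one_pow]
  -- the three reindexings
  have e1 : gaussSum ω (psiTilde ψ₀) = ∑ x, ω x * psiTilde ψ₀ (α * x) :=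
    gaussSum_eq_sum_mulShift ω (psiTilde ψ₀) hα0 hωα
  have e2 : gaussSum ω (psiTilde ψ₀) = ∑ x, ω x * psiTilde ψ₀ (α ^ 2 * x) :=
    gaussSum_eq_sum_mulShift ω (psiTilde ψ₀) hα20 hωα2
  -- `ψ(α² x) = ψ(x) ψ(α x)`
  have e3 : ∀ x, psiTilde ψ₀ (α ^ 2 * x) = psiTilde ψ₀ x * psiTilde ψ₀ (α * x) := by
    intro x
    rw [hα2, add_mul, one_mul, add_comm, AddChar.map_add_eq_mul]
  -- the bracket: `3` on the kernel set, `−1` off it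
  have hbr : ∀ x, psiTilde ψ₀ x + psiTilde ψ₀ (α * x) + psiTilde ψ₀ x * psiTilde ψ₀ (α * x) =
      -1 + 4 * (if x ^ 4 = x then (1 : ℂ) else 0) := by
    intro x
    have hiff : x ^ 4 = x ↔ (psiTilde ψ₀ x = 1 ∧ psiTilde ψ₀ (α * x) = 1) := by
      rw [← tr_zero_and_tr_mul_zero_iff hα1 hα3, psiTilde_eq_one_iff ψ₀ h₀,
        psiTilde_eq_one_iff ψ₀ h₀]
    rcases psiTilde_eq_one_or_neg_one ψ₀ h₀ x with hp | hp <;>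
      rcases psiTilde_eq_one_or_neg_one ψ₀ h₀ (α * x) with hq | hq
    · rw [if_pos (hiff.2 ⟨hp, hq⟩), hp, hq]; norm_num
    · have : ¬ x ^ 4 = x := fun h => by
        have := (hiff.1 h).2; rw [this] at hq; norm_num at hq
      rw [if_neg this, hp, hq]; norm_num
    · have : ¬ x ^ 4 = x := fun h => by
        have := (hiff.1 h).1; rw [this] at hp; norm_num at hp
      rw [if_neg this, hp, hq]; norm_num
    · have : ¬ x ^ 4 = x := fun h => by
        have := (hiff.1 h).1; rw [this] at hp; norm_num at hp
      rw [if_neg this, hp, hq]; norm_num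
  -- `3 G = ∑ ω(x) (−1 + 4 [x⁴ = x]) = −∑ ω + 4 ∑_{x⁴ = x} ω(x)`
  have h3G : 3 * gaussSum ω (psiTilde ψ₀) =
      ∑ x, ω x * (-1 + 4 * (if x ^ 4 = x then (1 : ℂ) else 0)) := by
    have hsplit : 3 * gaussSum ω (psiTilde ψ₀) =
        ∑ x, ω x * psiTilde ψ₀ x + ∑ x, ω x * psiTilde ψ₀ (α * x) +
          ∑ x, ω x * psiTilde ψ₀ (α ^ 2 * x) := by
      rw [← e1, ← e2]
      change 3 * gaussSum ω (psiTilde ψ₀) = gaussSum ω (psiTilde ψ₀) + _ + _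
      ring
    rw [hsplit, ← Finset.sum_add_distrib, ← Finset.sum_add_distrib]
    refine Finset.sum_congr rfl fun x _ => ?_
    rw [e3, ← mul_add, ← mul_add, hbr]
  have hsum0 : ∑ x, ω x = 0 := MulChar.sum_eq_zero_of_ne_one hω
  have hK : ∑ x, ω x * (if x ^ 4 = x then (1 : ℂ) else 0) = 3 := by
    have : ∀ x : F16, ω x * (if x ^ 4 = x then (1 : ℂ) else 0) = if x ^ 4 = x then ω x else 0 := by
      intro x; split_ifs <;> simp
    simp_rw [this]
    rw [← Finset.sum_filter]
    have hset : (Finset.univ.filter fun x : F16 => x ^ 4 = x) = {0, 1, α, α ^ 2} := by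
      ext x
      simp only [Finset.mem_filter, Finset.mem_univ, true_and, Finset.mem_insert, Finset.mem_singleton]
      exact pow_four_eq_self_iff hα1 hα3 x
    rw [hset]
    have h01 : (0 : F16) ∉ ({1, α, α ^ 2} : Finset F16) := by
      simp only [Finset.mem_insert, Finset.mem_singleton, not_or]
      exact ⟨zero_ne_one, fun h => hα0 h.symm, fun h => hα20 h.symm⟩
    have h1α : (1 : F16) ∉ ({α, α ^ 2} : Finset F16) := by
      simp only [Finset.mem_insert, Finset.mem_singleton, not_or]
      exact ⟨fun h => hα1 h.symm, fun h => hα21 h.symm⟩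
    have hαα : α ∉ ({α ^ 2} : Finset F16) := by
      simp only [Finset.mem_singleton]
      exact fun h => hα2α h.symm
    rw [Finset.sum_insert h01, Finset.sum_insert h1α, Finset.sum_insert hαα, Finset.sum_singleton,
      MulChar.map_zero, MulChar.map_one, hωα, hωα2]
    norm_num
  have h12 : 3 * gaussSum ω (psiTilde ψ₀) = 12 := by
    rw [h3G]
    have : ∀ x : F16, ω x * (-1 + 4 * (if x ^ 4 = x then (1 : ℂ) else 0)) =
        -ω x + 4 * (ω x * (if x ^ 4 = x then (1 : ℂ) else 0)) := by intro x; ring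
    simp_rw [this]
    rw [Finset.sum_add_distrib, Finset.sum_neg_distrib, ← Finset.mul_sum, hsum0, hK]
    norm_num
  linear_combination (1 / 3 : ℂ) * h12

/-- **The conductor-`1` root number at `𝔮 | 2` exactly**: `ε(½, ω, ψ̃) = ω(ϖ)^n` for every non-trivial
conjugate-dual tame `ω` (`κ = ¼`; Kudla's `ε = ω(ϖ)^n κ 𝔤(ω⁻¹, ψ̃)` with `𝔤 = 4`) — the sign of
`eps_eq_pm_piVal_pow` is `+`. -/
theorem eps_eq_piVal_pow (ψ₀ : AddChar (ZMod 2) ℂ) (h₀ : ψ₀ 1 ≠ 1) (n : ℕ) (ω : LocalChar F16)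
    (hω : ω.unit ≠ 1) (hσ : ∀ x, ω.unit (conj x) = ω.unit⁻¹ x) :
    LocalChar.eps (1 / 4) n ω (psiTilde ψ₀) = ω.piVal ^ n := by
  unfold LocalChar.eps LocalChar.gauss
  rw [gaussSum_inv_eq_of_conjDual ψ₀ ω.unit hσ, gaussSum_eq_four ψ₀ h₀ ω.unit hω hσ]
  ring

/-- The same for the standard `ψ₀ = (−1)^x`. -/
theorem eps_eq_piVal_pow_psi0 (n : ℕ) (ω : LocalChar F16) (hω : ω.unit ≠ 1)
    (hσ : ∀ x, ω.unit (conj x) = ω.unit⁻¹ x) :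
    LocalChar.eps (1 / 4) n ω (psiTilde psi0) = ω.piVal ^ n :=
  eps_eq_piVal_pow psi0 psi0_one_ne_one n ω hω hσ

/-! ### Consequences: (E3) at `𝔮` exactly, and the two classes of the route on the nose -/

/-- **(E3) at `𝔮 | 2` exactly from the `ϖ`-part of N2**: for four non-trivial conjugate-dual tame lines
`⟨ω_j, π_j⟩` — no Frobenius-orbit hypothesis, unlike `E3_inert_of_N2` — `ε_j = π_j^n`, so `ε₀ε₁ = ε₂ε₃`
follows from `π₀π₁ = π₂π₃`. -/
theorem E3_inert_exact (ψ₀ : AddChar (ZMod 2) ℂ) (h₀ : ψ₀ 1 ≠ 1) (n : ℕ) (ω : Fin 4 → LocalChar F16)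
    (hω : ∀ j, (ω j).unit ≠ 1) (hσ : ∀ j x, (ω j).unit (conj x) = (ω j).unit⁻¹ x)
    (hN2 : (ω 0).piVal * (ω 1).piVal = (ω 2).piVal * (ω 3).piVal) :
    LocalChar.eps (1 / 4) n (ω 0) (psiTilde ψ₀) * LocalChar.eps (1 / 4) n (ω 1) (psiTilde ψ₀) =
      LocalChar.eps (1 / 4) n (ω 2) (psiTilde ψ₀) * LocalChar.eps (1 / 4) n (ω 3) (psiTilde ψ₀) := by
  rw [eps_eq_piVal_pow ψ₀ h₀ n (ω 0) (hω 0) (hσ 0), eps_eq_piVal_pow ψ₀ h₀ n (ω 1) (hω 1) (hσ 1),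
    eps_eq_piVal_pow ψ₀ h₀ n (ω 2) (hω 2) (hσ 2), eps_eq_piVal_pow ψ₀ h₀ n (ω 3) (hω 3) (hσ 3),
    ← mul_pow, hN2, mul_pow]

/-- **Conjugate-symplectic tame characters at `𝔮` exactly** (`ω(ϖ) = −1` on the model): `ε(½, ω, ψ_δ) = (−1)^n`
— the `±` of `eps_conjSymplectic_inert` is `+`. -/
theorem eps_conjSymplectic_inert_exact (ψ₀ : AddChar (ZMod 2) ℂ) (h₀ : ψ₀ 1 ≠ 1) (n : ℕ) (ω : LocalChar F16)
    (hω : ω.unit ≠ 1) (hσ : ∀ x, ω.unit (conj x) = ω.unit⁻¹ x) (hπ : ω.piVal = -1) :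
    LocalChar.eps (1 / 4) n ω (psiTilde ψ₀) = (-1) ^ n := by
  rw [eps_eq_piVal_pow ψ₀ h₀ n ω hω hσ, hπ]

/-- **Conjugate-orthogonal tame characters at `𝔮` exactly** (`ω(ϖ) = 1`): `ε(½, ω, ψ_δ) = 1` — the `±` of
`eps_conjOrthogonal_inert` is `+`. -/
theorem eps_conjOrthogonal_inert_exact (ψ₀ : AddChar (ZMod 2) ℂ) (h₀ : ψ₀ 1 ≠ 1) (n : ℕ) (ω : LocalChar F16)
    (hω : ω.unit ≠ 1) (hσ : ∀ x, ω.unit (conj x) = ω.unit⁻¹ x) (hπ : ω.piVal = 1) :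
    LocalChar.eps (1 / 4) n ω (psiTilde ψ₀) = 1 := by
  rw [eps_eq_piVal_pow ψ₀ h₀ n ω hω hσ, hπ, one_pow]

end InertModel

end Summit.Ventures.HodgeRepro.PeriodCloser

end
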